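import HarnessLib
import Summits.RiemannHypothesis.RiemannHypothesis.Theorems.SignConeOscSingleWindowCertificateSuffices
import Summits.RiemannHypothesis.RiemannHypothesis.Theorems.SignConePointwiseCheckerDefs

/-!
# `OscSingleWindow` (crux stmt-RiemannHypothesis-18012): erasure certificates in the landed `PWData` format

Route `SignCone`, crux `Summit.RiemannHypothesis.RiemannHypothesis.Theses.SignCone.OscSingleWindow`.
The pointwise-certificate format of the unconditional rungs (`PWData`: kernel
`E_χ(x) = (e^{|x|/2} + e^{-|x|/2}) χ(|x|)` with `χ = 1` on `[0, L]` and `χ` piecewise linear on the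
knots `x_k = L + kh`, fake weights `a_n` on a node list, slack `s`; density `PWData.F`) carries an
ERASURE certificate for the single-window class (`SignConeOscSingleWindowCertificateSuffices.lean`)
as soon as

* `L ≥ log 2` (the near field is on the plateau), `s = 1`, nodes `≥ 2`, weights `≥ 0`;
* every knot value is `≤ 1` (so `E_χ ≤ e^{x/2} + e^{-x/2}`: erasure is legal where `Re F ≥ 0`);
* the knot values on a block `j₁ ≤ k ≤ j₂` are exactly `1` (so `E_χ = e^{x/2} + e^{-x/2}` on
  `[x_{j₁}, x_{j₂}]`, which must contain the window `[T, T + log 2]`).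

This file proves the piecewise-linear bookkeeping (`PWKernel.chiR_segment`, `chiR_le_one`,
`chiR_eq_one_of_block`; no new definitions) and the transfer `PWData.oscSingleWindowAt_of_checks`: such data with
`0 ≤ D.F` everywhere prove the crux at every window `T` with `x_{j₁} ≤ T`, `T + log 2 ≤ x_{j₂}`,
for every cutoff. The certificates themselves (data + kernel checks) are separate files.
-/

noncomputable section

-- `Summit.RiemannHypothesis.RiemannHypothesis.…` repeats a namespace component by design (D-0017 layout).
set_option linter.dupNamespace false

open scoped BigOperators
open Real MeasureTheory Set

namespace Summit.RiemannHypothesis.RiemannHypothesis.Theorems.SignCone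

open Literature.NumberTheory.LFunctions
open Literature.Analysis.SpecialFunctions (reDigammaQuarter)

namespace PWKernel

variable {d : PWKernel}

/-- Knot values beyond the last knot are `0`: `χ_k = 0` for `k ≥ K`. [folklore] -/
theorem chiAt_eq_zero_of_le {k : ℕ} (hk : d.K ≤ k) : d.chiAt k = 0 := by
  unfold chiAt
  unfold K at hk
  exact List.getD_eq_default _ _ (by omega)

/-- The knot as a real number: `x_k = L + k h`. [folklore] -/
theorem knot_cast (k : ℕ) : (d.knot k : ℝ) = d.L + k * d.h := by
  unfold knot; push_cast; ring

variable (hh : 0 < d.h)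
include hh

/-- On the segment `[x_j, x_{j+1}]` only the hats at `x_j` and `x_{j+1}` are non-zero. [folklore] -/
theorem hat_knot_eq_zero {j k : ℕ} {x : ℝ} (h1 : (d.knot j : ℝ) ≤ x) (h2 : x ≤ d.knot (j + 1))
    (hk : k ≠ j ∧ k ≠ j + 1) : hat (d.knot k : ℝ) d.h x = 0 := by
  have hh' : (0 : ℝ) < d.h := by exact_mod_cast hh
  rw [knot_cast] at h1 h2 ⊢
  push_cast at h2
  refine hat_of_le_abs hh' ?_
  rcases lt_or_gt_of_ne hk.1 with hlt | hgt
  · -- `k + 1 ≤ j`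
    have hkj : (k : ℝ) + 1 ≤ j := by exact_mod_cast Nat.succ_le_of_lt hlt
    rw [abs_of_nonneg (by nlinarith)]
    nlinarith
  · -- `j + 2 ≤ k`
    have hkj : (j : ℝ) + 2 ≤ k := by
      have : j + 2 ≤ k := by omega
      exact_mod_cast this
    rw [abs_of_nonpos (by nlinarith)]
    nlinarith

/-- **`χ` on a segment.** For `j + 1 ≤ K` and `x ∈ [x_j, x_{j+1}]`:
`χ(x) = χ'_j (x_{j+1} − x)/h + χ_{j+1} (x − x_j)/h` (linear interpolation of the knot values,
`χ'_0 = 1`, `χ_K = 0`). [folklore] -/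
theorem chiR_segment {j : ℕ} (hjK : j + 1 ≤ d.K) {x : ℝ} (h1 : (d.knot j : ℝ) ≤ x)
    (h2 : x ≤ d.knot (j + 1)) :
    d.chiR x = ((if j = 0 then (1 : ℚ) else d.chiAt j : ℚ) : ℝ) * (((d.knot (j + 1) : ℝ) - x) / d.h) +
      (d.chiAt (j + 1) : ℝ) * ((x - d.knot j) / d.h) := by
  have hh' : (0 : ℝ) < d.h := by exact_mod_cast hh
  have ej : (d.knot j : ℝ) = d.L + j * d.h := knot_cast j
  have ej1 : (d.knot (j + 1) : ℝ) = d.L + j * d.h + d.h := by rw [knot_cast]; push_cast; ring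
  unfold chiR
  rcases Nat.eq_zero_or_pos j with rfl | hj
  · -- `j = 0`: plateau ramp plus the hat at `x_1`
    simp only [if_true, Nat.cast_zero, zero_mul, add_zero, zero_add] at ej ej1 ⊢
    rw [ej] at h1
    rw [ej1] at h2
    have hp : plateau d.L d.h x = ((d.L : ℝ) + d.h - x) / d.h := plateau_of_mem hh' h1 h2
    have hs : ∑ k ∈ Finset.Ico 1 d.K, (d.chiAt k : ℝ) * hat (d.knot k) d.h x =
        (d.chiAt 1 : ℝ) * hat (d.knot 1) d.h x := by
      refine Finset.sum_eq_single 1 (fun k hk hk1 => ?_) (fun h1' => ?_)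
      · rw [Finset.mem_Ico] at hk
        rw [hat_knot_eq_zero hh (j := 0) (by rw [knot_cast]; push_cast; linarith)
          (by rw [knot_cast]; push_cast; linarith) ⟨by omega, by simpa using hk1⟩, mul_zero]
      · rw [Finset.mem_Ico] at h1'
        rw [chiAt_eq_zero_of_le (by omega)]
        push_cast; ring
    have hhat : hat (d.knot 1 : ℝ) d.h x = (x - d.L) / d.h := by
      rw [show (d.knot 1 : ℝ) = d.L + d.h by rw [knot_cast]; push_cast; ring]
      rw [hat_of_mem_left hh' (by linarith) h2]
      congr 1; ring
    rw [hp, hs, hhat, ej1, ej]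
    push_cast
    ring
  · -- `j ≥ 1`: no plateau, the hats at `x_j` and `x_{j+1}`
    simp only [hj.ne', if_false]
    have hp : plateau d.L d.h x = 0 := by
      refine plateau_of_ge hh' (le_trans ?_ h1)
      rw [ej]
      have : (1 : ℝ) ≤ j := by exact_mod_cast hj
      nlinarith
    have hs : ∑ k ∈ Finset.Ico 1 d.K, (d.chiAt k : ℝ) * hat (d.knot k) d.h x =
        (d.chiAt j : ℝ) * hat (d.knot j) d.h x + (d.chiAt (j + 1) : ℝ) * hat (d.knot (j + 1)) d.h x := by
      refine Finset.sum_eq_add j (j + 1) (by omega) (fun k _ hk => ?_) (fun hj' => ?_) (fun hj1 => ?_)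
      · rw [hat_knot_eq_zero hh h1 h2 hk, mul_zero]
      · exact absurd (Finset.mem_Ico.2 ⟨hj, by omega⟩) hj'
      · rw [Finset.mem_Ico] at hj1
        rw [chiAt_eq_zero_of_le (by omega)]
        push_cast; ring
    have hhat1 : hat (d.knot j : ℝ) d.h x = ((d.knot (j + 1) : ℝ) - x) / d.h := by
      rw [hat_of_mem_right hh' h1 (by rw [ej1] at h2; rw [ej]; linarith), ej, ej1]
    have hhat2 : hat (d.knot (j + 1) : ℝ) d.h x = (x - d.knot j) / d.h := by
      rw [hat_of_mem_left hh' (by rw [ej1]; rw [ej] at h1; linarith) h2, ej, ej1]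
      congr 1; ring
    rw [hp, hs, hhat1, hhat2, zero_add]

/-- Every `x ∈ [L, x_K)` lies in a segment `[x_j, x_{j+1}]` with `j + 1 ≤ K`. [folklore] -/
theorem exists_segment {x : ℝ} (hLx : (d.L : ℝ) ≤ x) (hxK : x < d.knot d.K) :
    ∃ j : ℕ, j + 1 ≤ d.K ∧ (d.knot j : ℝ) ≤ x ∧ x < d.knot (j + 1) := by
  have hh' : (0 : ℝ) < d.h := by exact_mod_cast hh
  set t : ℝ := (x - d.L) / d.h with ht
  have ht0 : 0 ≤ t := div_nonneg (by linarith) hh'.le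
  have hx : x = d.L + t * d.h := by rw [ht]; field_simp; ring
  refine ⟨⌊t⌋₊, ?_, ?_, ?_⟩
  · have htK : t < d.K := by
      rw [knot_cast] at hxK
      by_contra hle
      push Not at hle
      have : (d.L : ℝ) + d.K * d.h ≤ d.L + t * d.h := by nlinarith
      linarith
    exact Nat.succ_le_of_lt ((Nat.floor_lt ht0).2 htK)
  · rw [knot_cast, hx]
    nlinarith [Nat.floor_le ht0]
  · rw [knot_cast, hx]
    push_cast
    nlinarith [Nat.lt_floor_add_one t]

/-- Knots are strictly ordered: `x_a < x_b → a < b`. [folklore] -/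
theorem lt_of_knot_lt {a b : ℕ} (hab : (d.knot a : ℝ) < d.knot b) : a < b := by
  have hh' : (0 : ℝ) < d.h := by exact_mod_cast hh
  rw [knot_cast, knot_cast] at hab
  have : (a : ℝ) < b := by nlinarith
  exact_mod_cast this

/-- **`χ ≤ 1` when every knot value is `≤ 1`.** [folklore] -/
theorem chiR_le_one (hchi : ∀ k, d.chiAt k ≤ 1) (x : ℝ) : d.chiR x ≤ 1 := by
  have hh' : (0 : ℝ) < d.h := by exact_mod_cast hh
  rcases le_or_gt x d.L with hxL | hxL
  · rw [chiR_eq_one hh hxL]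
  rcases le_or_gt (d.knot d.K : ℝ) x with hxK | hxK
  · rw [chiR_eq_zero_of_ge hh hxK]; exact zero_le_one
  obtain ⟨j, hjK, h1, h2⟩ := exists_segment hh hxL.le hxK
  rw [chiR_segment hh hjK h1 h2.le]
  have w1 : 0 ≤ ((d.knot (j + 1) : ℝ) - x) / d.h := div_nonneg (by linarith) hh'.le
  have w2 : 0 ≤ (x - d.knot j) / d.h := div_nonneg (by linarith) hh'.le
  have wsum : ((d.knot (j + 1) : ℝ) - x) / d.h + (x - d.knot j) / d.h = 1 := by
    rw [knot_cast, knot_cast]; push_cast; field_simp; ring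
  have c1 : ((if j = 0 then (1 : ℚ) else d.chiAt j : ℚ) : ℝ) ≤ 1 := by
    split_ifs
    · push_cast; exact le_rfl
    · exact_mod_cast hchi j
  have c2 : (d.chiAt (j + 1) : ℝ) ≤ 1 := by exact_mod_cast hchi (j + 1)
  nlinarith [mul_le_mul_of_nonneg_right c1 w1, mul_le_mul_of_nonneg_right c2 w2]

/-- **`χ = 1` on a pinned block.** If `χ_k = 1` for `j₁ ≤ k ≤ j₂` (`1 ≤ j₁ ≤ j₂ ≤ K`) then `χ = 1`
on `[x_{j₁}, x_{j₂}]`. [folklore] -/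
theorem chiR_eq_one_of_block {j₁ j₂ : ℕ} (hj1 : 1 ≤ j₁) (hj12 : j₁ ≤ j₂) (hj2 : j₂ ≤ d.K)
    (hpin : ∀ k, j₁ ≤ k → k ≤ j₂ → d.chiAt k = 1) {x : ℝ} (hx1 : (d.knot j₁ : ℝ) ≤ x)
    (hx2 : x ≤ d.knot j₂) : d.chiR x = 1 := by
  have hh' : (0 : ℝ) < d.h := by exact_mod_cast hh
  rcases eq_or_lt_of_le hx2 with heq | hlt
  · -- right end point: segment `[x_{j₂-1}, x_{j₂}]`
    obtain ⟨i, rfl⟩ : ∃ i, j₂ = i + 1 := ⟨j₂ - 1, by omega⟩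
    have h1 : (d.knot i : ℝ) ≤ x := by
      rw [heq]; exact knot_mono hh (Nat.le_succ i)
    rw [chiR_segment hh hj2 h1 hx2, heq, hpin (i + 1) hj12 le_rfl, sub_self, zero_div, mul_zero,
      zero_add, knot_succ, add_sub_cancel_left, div_self hh'.ne', mul_one]
    push_cast
    rfl
  · have hLx : (d.L : ℝ) ≤ x := by
      refine le_trans ?_ hx1
      have := knot_mono hh (Nat.zero_le j₁) (d := d)
      rwa [show (d.knot 0 : ℝ) = d.L by rw [knot_cast]; push_cast; ring] at this
    have hxK : x < d.knot d.K := hlt.trans_le (knot_mono hh hj2)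
    obtain ⟨j, hjK, h1, h2⟩ := exists_segment hh hLx hxK
    have hj1' : j₁ ≤ j := Nat.lt_succ_iff.1 (lt_of_knot_lt hh (hx1.trans_lt h2))
    have hj2' : j + 1 ≤ j₂ := Nat.succ_le_of_lt (lt_of_knot_lt hh (h1.trans_lt hlt))
    have cj : (if j = 0 then (1 : ℚ) else d.chiAt j) = 1 := by
      split_ifs with h0
      · rfl
      · exact hpin j hj1' (by omega)
    rw [chiR_segment hh hjK h1 h2.le, cj, hpin (j + 1) (by omega) hj2']
    rw [knot_cast, knot_cast]; push_cast; field_simp; ring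

/-- **Erasure is legal**: `E_χ ≤ e^{x/2} + e^{-x/2}` when every knot value is `≤ 1`. [folklore] -/
theorem kernelE_le (hchi : ∀ k, d.chiAt k ≤ 1) (x : ℝ) :
    d.kernelE x ≤ Real.exp (x / 2) + Real.exp (-(x / 2)) := by
  unfold kernelE
  have hpos : 0 < Real.exp (|x| / 2) + Real.exp (-(|x| / 2)) := by positivity
  have habs : Real.exp (|x| / 2) + Real.exp (-(|x| / 2)) = Real.exp (x / 2) + Real.exp (-(x / 2)) := by
    rcases le_or_gt 0 x with h0 | h0
    · rw [abs_of_nonneg h0]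
    · rw [abs_of_neg h0, neg_div, neg_neg, add_comm]
  rw [← habs]
  exact mul_le_of_le_one_right hpos.le (chiR_le_one hh hchi _)

/-- **The pinned block**: `E_χ(x) = e^{x/2} + e^{-x/2}` for `x_{j₁} ≤ |x| ≤ x_{j₂}` when `χ_k = 1`
for `j₁ ≤ k ≤ j₂`. [folklore] -/
theorem kernelE_eq_of_block {j₁ j₂ : ℕ} (hj1 : 1 ≤ j₁) (hj12 : j₁ ≤ j₂) (hj2 : j₂ ≤ d.K)
    (hpin : ∀ k, j₁ ≤ k → k ≤ j₂ → d.chiAt k = 1) {x : ℝ} (hx1 : (d.knot j₁ : ℝ) ≤ |x|)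
    (hx2 : |x| ≤ d.knot j₂) : d.kernelE x = Real.exp (x / 2) + Real.exp (-(x / 2)) := by
  unfold kernelE
  rw [chiR_eq_one_of_block hh hj1 hj12 hj2 hpin hx1 hx2, mul_one]
  rcases le_or_gt 0 x with h0 | h0
  · rw [abs_of_nonneg h0]
  · rw [abs_of_neg h0, neg_div, neg_neg, add_comm]

end PWKernel

namespace PWData

/-- **A `PWData` erasure certificate proves `OscSingleWindow` at every window inside its pinned
block** (crux stmt-RiemannHypothesis-18012 with the window parameter `T` fixed; body verbatim over
Mathlib primitives, every cutoff `a`). Hypotheses: slack `s = 1`, `h > 0`, `L ≥ log 2`, knot values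
`≤ 1`, a pinned block `χ_k = 1` (`j₁ ≤ k ≤ j₂`) with `x_{j₁} ≤ T` and `T + log 2 ≤ x_{j₂}`, nodes
`≥ 2` with weights `≥ 0`, and the density `D.F ≥ 0` everywhere (the part a kernel computation
certifies). [folklore] -/
theorem oscSingleWindowAt_of_checks (D : PWData) (hs : D.s = 1) (hh : 0 < D.d.h)
    (hL : Real.log 2 ≤ (D.d.L : ℝ)) (hchi : ∀ q ∈ D.d.chi, q ≤ 1) {j₁ j₂ : ℕ} (hj1 : 1 ≤ j₁)
    (hj12 : j₁ ≤ j₂) (hj2 : j₂ ≤ D.d.K) (hpin : ∀ k, j₁ ≤ k → k ≤ j₂ → D.d.chiAt k = 1)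
    (hnodes : ∀ n ∈ D.nodeList, 2 ≤ n) (ha : ∀ n ∈ D.nodeList, 0 ≤ D.a n) (hF : ∀ y : ℝ, 0 ≤ D.F y)
    {T : ℝ} (hT1 : (D.d.knot j₁ : ℝ) ≤ T) (hT2 : T + Real.log 2 ≤ D.d.knot j₂) :
    ∀ a : ℝ, 0 < a → ∀ (k : ℕ) (g : Fin k → ℝ → ℂ), (∀ i, (ContDiff ℝ ((⊤ : ℕ∞) : WithTop ℕ∞) (g i) ∧ HasCompactSupport (g i)) ∧ tsupport (g i) ⊆ Set.Icc (-a) a) → let F : ℝ → ℂ := fun t => ∑ i, MeasureTheory.convolution (g i) (fun u => (starRingEnd ℂ) ((g i) (-u))) (ContinuousLinearMap.mul ℂ ℂ) MeasureTheory.MeasureSpace.volume t; (∀ n : ℕ, 2 ≤ n → 0 ≤ (F (Real.log n)).re) → (∀ t : ℝ, Real.log 2 ≤ |t| → (F t).re < 0 → T ≤ |t| ∧ |t| ≤ T + Real.log 2) → (∃ t : ℝ, Real.log 2 ≤ |t| ∧ (F t).re < 0) → let M : ℂ → ℂ := fun s => ∫ u : ℝ, F u * Complex.exp ((s - 1 /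 2) * u); -(F 0).re ≤ (M 0 + M 1 + ((1 / (2 * Real.pi) : ℂ) * (∫ t : ℝ, M (1 / 2 + t * Complex.I) * ((Complex.digamma (1 / 4 + t / 2 * Complex.I)).re : ℂ)) - F 0 * (Real.log Real.pi : ℂ))).re := by
  -- knot values `≤ 1` at every index (the default beyond the list is `0`)
  have hchi' : ∀ k, D.d.chiAt k ≤ 1 := by
    intro k
    unfold PWKernel.chiAt
    rcases lt_or_ge (k - 1) D.d.chi.length with hlt | hge
    · rw [List.getD_eq_getElem _ _ hlt]
      exact hchi _ (List.getElem_mem hlt)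
    · rw [List.getD_eq_default _ _ hge]
      exact zero_le_one
  -- the erasure conditions of the kernel
  have hEle := PWKernel.kernelE_le hh hchi'
  have hEeq : ∀ x : ℝ, (|x| < Real.log 2 ∨ (T ≤ |x| ∧ |x| ≤ T + Real.log 2)) →
      D.d.kernelE x = Real.exp (x / 2) + Real.exp (-(x / 2)) := by
    intro x hx
    rcases hx with hx | hx
    · exact PWKernel.kernelE_eq_of_abs_le hh (hx.le.trans hL)
    · exact PWKernel.kernelE_eq_of_block hh hj1 hj12 hj2 hpin (hT1.trans hx.1) (by linarith [hx.2])
  -- the density, with slack `1` and real weights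
  have hD : ∀ y : ℝ, 0 ≤ reDigammaQuarter y - Real.log Real.pi + 1 + cosTransform D.d.kernelE y -
      ∑ n ∈ D.nodeList.toFinset, (fun n => (D.a n : ℝ)) n * Real.cos (y * Real.log n) := by
    intro y
    have h := hF y
    unfold PWData.F at h
    rw [hs] at h
    push_cast at h
    exact h
  exact oscSingleWindowAt_of_erasure D.d.continuous_kernelE (PWKernel.hasCompactSupport_kernelE hh)
    hEle hEeq D.nodeList.toFinset (fun n hn => hnodes n (List.mem_toFinset.1 hn))
    (fun n => (D.a n : ℝ)) (fun n hn => by exact_mod_cast ha n (List.mem_toFinset.1 hn)) hD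

end PWData

end Summit.RiemannHypothesis.RiemannHypothesis.Theorems.SignCone

end
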